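import Summits.NavierStokesRegularity.NavierStokesRegularity.Theses.RellichScar
import Summits.NavierStokesRegularity.NavierStokesRegularity.Theorems.ScarRigidity.Negative.LogicAndLoadBearing
import Literature.Analysis.FluidPDE.TypeIAncientMild
import Literature.Analysis.FluidPDE.ParasiticSlabFlow
import Summits.NavierStokesRegularity.NavierStokesRegularity.Theorems.RellichScarScarRigidityCoulombFlux
import Summits.NavierStokesRegularity.NavierStokesRegularity.Theorems.RellichScarScarRigidityCoulombKernel
import HarnessLib

/-!
# `ScarRigidity` — line `finite-energy-log-convexity`, stub `stub_coulombEnergyPackage`: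
# the Green identities of the Coulomb energy package (crux stmt-NavierStokesRegularity-11717)

Helper file 9 of S4-E (`stub_coulombEnergyPackage`). For two `C²` fields `w, ψ` on `ℝ³` with
`Δψ = w` and the decay of an apex density and of its Newtonian potential,
`‖w‖ ≲ (1+‖x‖)⁻³`, `‖Dw‖ ≲ (1+‖x‖)⁻²`, `‖∂ᵢ∂ᵢw‖ ≲ (1+‖x‖)⁻³`, `‖ψ‖ ≲ ‖x‖^{-3/4}`,
`‖Dψ‖ ≲ (1+‖x‖)^{-7/4}`, `‖∂ᵢ∂ᵢψ‖ ≲ (1+‖x‖)^{-5/2}` (`…CoulombField`), the weighted Green identity of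
`…CoulombFlux` applies to the three pairs `(ψ,ψ)`, `(ψ,w)`, `(w,ψ)` (every product is
`≲ (1+‖x‖)^{-r} ‖x‖^{-s}` with `r + s > 3`, `s < 3`) and yields the **energy identities of the
Agmon–Nirenberg frame in `Ḣ⁻¹`** (`green_identities_of_decay`):

  `Σᵢ ∫ ‖∂ᵢψ‖² = -∫ ⟪w, ψ⟫` (the Coulomb energy `N = ‖∇ψ‖²₂ ≥ 0`),
  `Σᵢ ∫ ⟪∂ᵢψ, ∂ᵢw⟫ = -∫ ‖w‖²`,  `∫ ⟪Δw, ψ⟫ = ∫ ‖w‖²`,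

together with the integrability of `⟪w, ψ⟫`, `‖∂ᵢψ‖²`, `⟪∂ᵢψ, ∂ᵢw⟫`, `‖∂ᵢw‖²`. The reference weights
`(1+‖x‖)^{-r}` (`r > 3`) and `(1+‖x‖)^{-r}‖x‖^{-s}` (`0 < s < 3 < r + s`) are integrable
(`integrable_of_le_one_add_norm_rpow`, `integrable_of_le_one_add_norm_rpow_mul_rpow`).
-/

noncomputable section

open Set Filter Function MeasureTheory Metric TopologicalSpace
open scoped Topology ENNReal NNReal InnerProductSpace RealInnerProductSpace
open Literature.Analysis.FluidPDE
open Summit.NavierStokesRegularity.NavierStokesRegularity.Theses.RellichScar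
open Summit.NavierStokesRegularity.NavierStokesRegularity.Theorems.ScarRigidity.Negative

set_option linter.dupNamespace false

namespace Summit.NavierStokesRegularity.NavierStokesRegularity.Theorems.RellichScarScarRigidity

open Real RieszKernel
open scoped Laplacian

/-! ## Integrable reference weights -/

/-- `x ↦ (1+‖x‖)^{-r} ‖x‖^{-s} ∈ L¹(ℝ³)` for `s < 3 < r + s`, `0 ≤ r` (unit ball: `≤ ‖x‖^{-s}`;
outside: `≤ ‖x‖^{-(r+s)}`). [folklore] -/
theorem integrable_one_add_norm_rpow_mul_rpow {r s : ℝ} (hr : 0 ≤ r) (hs3 : s < 3)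
    (hrs : 3 < r + s) :
    Integrable (fun x : EuclideanSpace ℝ (Fin 3) => (1 + ‖x‖) ^ (-r) * ‖x‖ ^ (-s)) volume := by
  set f : (EuclideanSpace ℝ (Fin 3)) → ℝ := fun x => (1 + ‖x‖) ^ (-r) * ‖x‖ ^ (-s) with hf
  have hf0 : ∀ x, 0 ≤ f x := fun x => by positivity
  have hfm : Measurable f :=
    ((measurable_const.add measurable_norm).pow_const _).mul (measurable_norm.pow_const _)
  have hball : ∫⁻ x in ball (0 : EuclideanSpace ℝ (Fin 3)) 1, ENNReal.ofReal (f x) < ⊤ := by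
    have hle : ∀ x : EuclideanSpace ℝ (Fin 3), ENNReal.ofReal (f x) ≤ powKer s x := by
      intro x
      rw [powKer_apply]
      refine ENNReal.ofReal_le_ofReal ?_
      have h1 : (1 + ‖x‖) ^ (-r) ≤ 1 := by
        rw [Real.rpow_neg (by positivity)]
        exact inv_le_one_of_one_le₀ (Real.one_le_rpow (by linarith [norm_nonneg x]) hr)
      calc f x = (1 + ‖x‖) ^ (-r) * ‖x‖ ^ (-s) := rfl
        _ ≤ 1 * ‖x‖ ^ (-s) := mul_le_mul_of_nonneg_right h1 (by positivity)
        _ = ‖x‖ ^ (-s) := one_mul _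
    exact lt_of_le_of_lt (lintegral_mono fun x => hle x) (lintegral_ball_powKer_lt_top hs3 1)
  have hfar : ∫⁻ x in (ball (0 : EuclideanSpace ℝ (Fin 3)) 1)ᶜ, ENNReal.ofReal (f x) < ⊤ := by
    have hle : ∀ x ∈ (ball (0 : EuclideanSpace ℝ (Fin 3)) 1)ᶜ, ENNReal.ofReal (f x) ≤ powKer (r + s) x := by
      intro x hx
      have hx1 : 1 ≤ ‖x‖ := by simpa using hx
      have hx0 : 0 < ‖x‖ := by linarith
      rw [powKer_apply]
      refine ENNReal.ofReal_le_ofReal ?_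
      show (1 + ‖x‖) ^ (-r) * ‖x‖ ^ (-s) ≤ ‖x‖ ^ (-(r + s))
      rw [neg_add, Real.rpow_add hx0]
      refine mul_le_mul_of_nonneg_right ?_ (by positivity)
      exact Real.rpow_le_rpow_of_nonpos hx0 (by linarith) (by linarith)
    exact lt_of_le_of_lt (setLIntegral_mono' isOpen_ball.measurableSet.compl hle)
      (lintegral_compl_ball_powKer_lt_top hrs one_pos)
  refine ⟨hfm.aestronglyMeasurable, ?_⟩
  rw [hasFiniteIntegral_iff_enorm]
  calc ∫⁻ x, ‖f x‖ₑ = ∫⁻ x, ENNReal.ofReal (f x) := lintegral_congr fun x => Real.enorm_eq_ofReal (hf0 x)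
    _ = (∫⁻ x in ball (0 : EuclideanSpace ℝ (Fin 3)) 1, ENNReal.ofReal (f x)) +
          ∫⁻ x in (ball (0 : EuclideanSpace ℝ (Fin 3)) 1)ᶜ, ENNReal.ofReal (f x) :=
        (lintegral_add_compl _ measurableSet_ball).symm
    _ < ⊤ := ENNReal.add_lt_top.2 ⟨hball, hfar⟩

/-- **Integrability from a pure weight**: `‖f‖ ≤ M (1+‖x‖)^{-r}` with `r > 3`. [folklore] -/
theorem integrable_of_le_one_add_norm_rpow {F : Type*} [NormedAddCommGroup F]
    {f : (EuclideanSpace ℝ (Fin 3)) → F} (hf : AEStronglyMeasurable f volume) {M r : ℝ}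
    (hr : 3 < r) (h : ∀ x, ‖f x‖ ≤ M * (1 + ‖x‖) ^ (-r)) : Integrable f volume := by
  have hr' : (Module.finrank ℝ (EuclideanSpace ℝ (Fin 3)) : ℝ) < r := by
    rw [finrank_euclideanSpace, Fintype.card_fin]; exact_mod_cast hr
  exact ((integrable_one_add_norm hr').const_mul M).mono' hf (Eventually.of_forall h)

/-- **Integrability from a mixed weight**: `‖f‖ ≤ M (1+‖x‖)^{-r} ‖x‖^{-s}` for `x ≠ 0`, with
`0 ≤ r`, `s < 3 < r + s`. [folklore] -/
theorem integrable_of_le_one_add_norm_rpow_mul_rpow {F : Type*} [NormedAddCommGroup F]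
    {f : (EuclideanSpace ℝ (Fin 3)) → F} (hf : AEStronglyMeasurable f volume) {M r s : ℝ}
    (hr : 0 ≤ r) (hs3 : s < 3) (hrs : 3 < r + s)
    (h : ∀ x, x ≠ 0 → ‖f x‖ ≤ M * ((1 + ‖x‖) ^ (-r) * ‖x‖ ^ (-s))) : Integrable f volume := by
  refine ((integrable_one_add_norm_rpow_mul_rpow hr hs3 hrs).const_mul M).mono' hf ?_
  have hae : ∀ᵐ x ∂(volume : Measure (EuclideanSpace ℝ (Fin 3))), x ≠ (0 : EuclideanSpace ℝ (Fin 3)) := by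
    rw [ae_iff]; simp [measure_singleton]
  filter_upwards [hae] with x hx using h x hx

/-! ## Pointwise algebra of the weights -/

/-- `(1+‖x‖)^{-r₁} (1+‖x‖)^{-r₂} = (1+‖x‖)^{-(r₁+r₂)}`. [folklore] -/
theorem one_add_norm_rpow_mul {E : Type*} [NormedAddCommGroup E] (x : E) (r₁ r₂ : ℝ) :
    (1 + ‖x‖) ^ (-r₁) * (1 + ‖x‖) ^ (-r₂) = (1 + ‖x‖) ^ (-(r₁ + r₂)) := by
  rw [← Real.rpow_add (by positivity), neg_add]

/-- `|⟪u, v⟫| ≤ p q` from `‖u‖ ≤ p`, `‖v‖ ≤ q` (`p ≥ 0`). [folklore] -/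
theorem norm_inner_le_of_le {u v : EuclideanSpace ℝ (Fin 3)} {p q : ℝ} (hu : ‖u‖ ≤ p) (hv : ‖v‖ ≤ q)
    (hp : 0 ≤ p) : ‖⟪u, v⟫‖ ≤ p * q :=
  (norm_inner_le_norm u v).trans (mul_le_mul hu hv (norm_nonneg _) hp)

/-- `‖L e‖ ≤ ‖L‖` for a unit vector `e`. [folklore] -/
theorem norm_apply_le_opNorm_of_unit {F : Type*} [NormedAddCommGroup F] [NormedSpace ℝ F]
    (L : (EuclideanSpace ℝ (Fin 3)) →L[ℝ] F) {e : EuclideanSpace ℝ (Fin 3)} (he : ‖e‖ = 1) :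
    ‖L e‖ ≤ ‖L‖ := by
  simpa [he] using L.le_opNorm e

/-! ## The Green identities of the package -/

/-- **The energy identities of the Coulomb package.** For `C²` fields `w, ψ : ℝ³ → ℝ³` with
`Δψ = w` and the decay `‖w‖ ≤ A(1+‖x‖)⁻³`, `‖Dw‖ ≤ A₁(1+‖x‖)⁻²`, `‖∂ᵢ∂ᵢw‖ ≤ A₂(1+‖x‖)⁻³`,
`‖ψ‖ ≤ P₀‖x‖^{-3/4}` (`x ≠ 0`), `‖Dψ‖ ≤ P₁(1+‖x‖)^{-7/4}`, `‖∂ᵢ∂ᵢψ‖ ≤ P₂(1+‖x‖)^{-5/2}`: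
`⟪w, ψ⟫`, `‖∂ᵢψ‖²`, `⟪∂ᵢψ, ∂ᵢw⟫`, `‖∂ᵢw‖²` are integrable and
`Σᵢ ∫ ‖∂ᵢψ‖² = -∫ ⟪w, ψ⟫`, `Σᵢ ∫ ⟪∂ᵢψ, ∂ᵢw⟫ = -∫ ‖w‖²`, `∫ ⟪Δw, ψ⟫ = ∫ ‖w‖²`
(the weighted Green identity for the pairs `(ψ,ψ)`, `(ψ,w)`, `(w,ψ)`). [folklore] -/
theorem green_identities_of_decay
    {w ψ : (EuclideanSpace ℝ (Fin 3)) → (EuclideanSpace ℝ (Fin 3))}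
    (hw : ContDiff ℝ 2 w) (hψ : ContDiff ℝ 2 ψ) (hΔ : ∀ x, (Δ ψ) x = w x)
    {A A₁ A₂ P₀ P₁ P₂ : ℝ} (hA : 0 ≤ A) (hA₁ : 0 ≤ A₁) (hA₂ : 0 ≤ A₂) (hP₁ : 0 ≤ P₁) (hP₂ : 0 ≤ P₂)
    (hwb : ∀ x, ‖w x‖ ≤ A * (1 + ‖x‖) ^ (-(3 : ℝ)))
    (hw1 : ∀ x, ‖fderiv ℝ w x‖ ≤ A₁ * (1 + ‖x‖) ^ (-(2 : ℝ)))
    (hw2 : ∀ (x) (i : Fin 3), ‖fderiv ℝ (fun y => fderiv ℝ w y (EuclideanSpace.basisFun (Fin 3) ℝ i)) x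
      (EuclideanSpace.basisFun (Fin 3) ℝ i)‖ ≤ A₂ * (1 + ‖x‖) ^ (-(3 : ℝ)))
    (hψ0 : ∀ x, x ≠ 0 → ‖ψ x‖ ≤ P₀ * ‖x‖ ^ (-(3 / 4 : ℝ)))
    (hψ1 : ∀ x, ‖fderiv ℝ ψ x‖ ≤ P₁ * (1 + ‖x‖) ^ (-(7 / 4 : ℝ)))
    (hψ2 : ∀ (x) (i : Fin 3), ‖fderiv ℝ (fun y => fderiv ℝ ψ y (EuclideanSpace.basisFun (Fin 3) ℝ i)) x
      (EuclideanSpace.basisFun (Fin 3) ℝ i)‖ ≤ P₂ * (1 + ‖x‖) ^ (-(5 / 2 : ℝ))) :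
    Integrable (fun x => ⟪w x, ψ x⟫) volume ∧
    (∀ i : Fin 3, Integrable (fun x => ‖fderiv ℝ ψ x (EuclideanSpace.basisFun (Fin 3) ℝ i)‖ ^ 2) volume) ∧
    (∀ i : Fin 3, Integrable (fun x => ⟪fderiv ℝ ψ x (EuclideanSpace.basisFun (Fin 3) ℝ i),
      fderiv ℝ w x (EuclideanSpace.basisFun (Fin 3) ℝ i)⟫) volume) ∧
    (∀ i : Fin 3, Integrable (fun x => ‖fderiv ℝ w x (EuclideanSpace.basisFun (Fin 3) ℝ i)‖ ^ 2) volume) ∧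
    (∑ i : Fin 3, ∫ x, ‖fderiv ℝ ψ x (EuclideanSpace.basisFun (Fin 3) ℝ i)‖ ^ 2) = -∫ x, ⟪w x, ψ x⟫ ∧
    (∑ i : Fin 3, ∫ x, ⟪fderiv ℝ ψ x (EuclideanSpace.basisFun (Fin 3) ℝ i),
      fderiv ℝ w x (EuclideanSpace.basisFun (Fin 3) ℝ i)⟫) = -∫ x, ‖w x‖ ^ 2 ∧
    ∫ x, ⟪(Δ w) x, ψ x⟫ = ∫ x, ‖w x‖ ^ 2 := by
  set e := EuclideanSpace.basisFun (Fin 3) ℝ with he_def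
  have he1 : ∀ i, ‖e i‖ = 1 := fun i => e.norm_eq_one i
  have hw1' : ContDiff ℝ 1 w := hw.of_le one_le_two
  have hψ1' : ContDiff ℝ 1 ψ := hψ.of_le one_le_two
  -- continuity of the building blocks
  have hcw : Continuous w := hw.continuous
  have hcψ : Continuous ψ := hψ.continuous
  have hcDw : ∀ i, Continuous fun x => fderiv ℝ w x (e i) := fun i =>
    (hw1'.continuous_fderiv one_ne_zero).clm_apply continuous_const
  have hcDψ : ∀ i, Continuous fun x => fderiv ℝ ψ x (e i) := fun i =>
    (hψ1'.continuous_fderiv one_ne_zero).clm_apply continuous_const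
  have hcD2w : ∀ i, Continuous fun x => fderiv ℝ (fun y => fderiv ℝ w y (e i)) x (e i) := fun i =>
    ((((hw.fderiv_right (m := 1) le_rfl).clm_apply contDiff_const).continuous_fderiv
      one_ne_zero).clm_apply continuous_const)
  have hcD2ψ : ∀ i, Continuous fun x => fderiv ℝ (fun y => fderiv ℝ ψ y (e i)) x (e i) := fun i =>
    ((((hψ.fderiv_right (m := 1) le_rfl).clm_apply contDiff_const).continuous_fderiv
      one_ne_zero).clm_apply continuous_const)
  -- pointwise sizes of the first derivatives along the basis
  have hDwi : ∀ x i, ‖fderiv ℝ w x (e i)‖ ≤ A₁ * (1 + ‖x‖) ^ (-(2 : ℝ)) := fun x i =>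
    (norm_apply_le_opNorm_of_unit _ (he1 i)).trans (hw1 x)
  have hDψi : ∀ x i, ‖fderiv ℝ ψ x (e i)‖ ≤ P₁ * (1 + ‖x‖) ^ (-(7 / 4 : ℝ)) := fun x i =>
    (norm_apply_le_opNorm_of_unit _ (he1 i)).trans (hψ1 x)
  have hx1 : ∀ x : EuclideanSpace ℝ (Fin 3), (1 + ‖x‖)⁻¹ = (1 + ‖x‖) ^ (-(1 : ℝ)) := fun x =>
    (Real.rpow_neg_one _).symm
  -- (1) `⟪w, ψ⟫ ∈ L¹`
  have I1 : Integrable (fun x => ⟪w x, ψ x⟫) volume := by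
    refine integrable_of_le_one_add_norm_rpow_mul_rpow (hcw.inner hcψ).aestronglyMeasurable
      (M := A * P₀) (r := 3) (s := 3 / 4) (by norm_num) (by norm_num) (by norm_num) fun x hx => ?_
    calc ‖⟪w x, ψ x⟫‖ ≤ A * (1 + ‖x‖) ^ (-(3 : ℝ)) * (P₀ * ‖x‖ ^ (-(3 / 4 : ℝ))) :=
          norm_inner_le_of_le (hwb x) (hψ0 x hx) (by positivity)
      _ = A * P₀ * ((1 + ‖x‖) ^ (-(3 : ℝ)) * ‖x‖ ^ (-(3 / 4 : ℝ))) := by ring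
  -- (2) `‖∂ᵢψ‖² ∈ L¹`
  have I2 : ∀ i, Integrable (fun x => ‖fderiv ℝ ψ x (e i)‖ ^ 2) volume := by
    intro i
    refine integrable_of_le_one_add_norm_rpow ((hcDψ i).norm.pow 2).aestronglyMeasurable
      (M := P₁ ^ 2) (r := 7 / 2) (by norm_num) fun x => ?_
    rw [Real.norm_of_nonneg (sq_nonneg _)]
    calc ‖fderiv ℝ ψ x (e i)‖ ^ 2 ≤ (P₁ * (1 + ‖x‖) ^ (-(7 / 4 : ℝ))) ^ 2 :=
          pow_le_pow_left₀ (norm_nonneg _) (hDψi x i) 2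
      _ = P₁ ^ 2 * (1 + ‖x‖) ^ (-(7 / 2 : ℝ)) := by
          have h : ((1 + ‖x‖) ^ (-(7 / 4 : ℝ))) ^ 2 = (1 + ‖x‖) ^ (-(7 / 2 : ℝ)) := by
            rw [← Real.rpow_natCast, ← Real.rpow_mul (by positivity)]; norm_num
          rw [mul_pow, h]
  -- (3) `⟪∂ᵢψ, ∂ᵢw⟫ ∈ L¹`
  have I3 : ∀ i, Integrable (fun x => ⟪fderiv ℝ ψ x (e i), fderiv ℝ w x (e i)⟫) volume := by
    intro i
    refine integrable_of_le_one_add_norm_rpow ((hcDψ i).inner (hcDw i)).aestronglyMeasurable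
      (M := P₁ * A₁) (r := 15 / 4) (by norm_num) fun x => ?_
    calc ‖⟪fderiv ℝ ψ x (e i), fderiv ℝ w x (e i)⟫‖
        ≤ P₁ * (1 + ‖x‖) ^ (-(7 / 4 : ℝ)) * (A₁ * (1 + ‖x‖) ^ (-(2 : ℝ))) :=
          norm_inner_le_of_le (hDψi x i) (hDwi x i) (by positivity)
      _ = P₁ * A₁ * ((1 + ‖x‖) ^ (-(7 / 4 : ℝ)) * (1 + ‖x‖) ^ (-(2 : ℝ))) := by ring
      _ = P₁ * A₁ * (1 + ‖x‖) ^ (-(15 / 4 : ℝ)) := by rw [one_add_norm_rpow_mul]; norm_num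
  -- (4) `‖∂ᵢw‖² ∈ L¹`
  have I4 : ∀ i, Integrable (fun x => ‖fderiv ℝ w x (e i)‖ ^ 2) volume := by
    intro i
    refine integrable_of_le_one_add_norm_rpow ((hcDw i).norm.pow 2).aestronglyMeasurable
      (M := A₁ ^ 2) (r := 4) (by norm_num) fun x => ?_
    rw [Real.norm_of_nonneg (sq_nonneg _)]
    calc ‖fderiv ℝ w x (e i)‖ ^ 2 ≤ (A₁ * (1 + ‖x‖) ^ (-(2 : ℝ))) ^ 2 :=
          pow_le_pow_left₀ (norm_nonneg _) (hDwi x i) 2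
      _ = A₁ ^ 2 * (1 + ‖x‖) ^ (-(4 : ℝ)) := by
          have h : ((1 + ‖x‖) ^ (-(2 : ℝ))) ^ 2 = (1 + ‖x‖) ^ (-(4 : ℝ)) := by
            rw [← Real.rpow_natCast, ← Real.rpow_mul (by positivity)]; norm_num
          rw [mul_pow, h]
  -- the fluxes and second-order terms of the three Green identities
  have Hψψ : ∀ i, Integrable (fun x => (1 + ‖x‖)⁻¹ * |⟪fderiv ℝ ψ x (e i), ψ x⟫|) volume := by
    intro i
    refine integrable_of_le_one_add_norm_rpow_mul_rpow
      (((continuous_const.add continuous_norm).inv₀ fun x => (by positivity : (0:ℝ) < 1 + ‖x‖).ne').mul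
        ((hcDψ i).inner hcψ).abs).aestronglyMeasurable
      (M := P₁ * P₀) (r := 11 / 4) (s := 3 / 4) (by norm_num) (by norm_num) (by norm_num) fun x hx => ?_
    rw [norm_mul, Real.norm_of_nonneg (by positivity), Real.norm_eq_abs, abs_abs, ← Real.norm_eq_abs, hx1]
    calc (1 + ‖x‖) ^ (-(1 : ℝ)) * ‖⟪fderiv ℝ ψ x (e i), ψ x⟫‖
        ≤ (1 + ‖x‖) ^ (-(1 : ℝ)) * (P₁ * (1 + ‖x‖) ^ (-(7 / 4 : ℝ)) * (P₀ * ‖x‖ ^ (-(3 / 4 : ℝ)))) :=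
          mul_le_mul_of_nonneg_left (norm_inner_le_of_le (hDψi x i) (hψ0 x hx) (by positivity))
            (by positivity)
      _ = P₁ * P₀ * (((1 + ‖x‖) ^ (-(1 : ℝ)) * (1 + ‖x‖) ^ (-(7 / 4 : ℝ))) * ‖x‖ ^ (-(3 / 4 : ℝ))) := by
          ring
      _ = P₁ * P₀ * ((1 + ‖x‖) ^ (-(11 / 4 : ℝ)) * ‖x‖ ^ (-(3 / 4 : ℝ))) := by
          rw [one_add_norm_rpow_mul]; norm_num
  have Kψψ : ∀ i, Integrable (fun x => ⟪fderiv ℝ (fun y => fderiv ℝ ψ y (e i)) x (e i), ψ x⟫) volume := by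
    intro i
    refine integrable_of_le_one_add_norm_rpow_mul_rpow ((hcD2ψ i).inner hcψ).aestronglyMeasurable
      (M := P₂ * P₀) (r := 5 / 2) (s := 3 / 4) (by norm_num) (by norm_num) (by norm_num) fun x hx => ?_
    calc ‖⟪fderiv ℝ (fun y => fderiv ℝ ψ y (e i)) x (e i), ψ x⟫‖
        ≤ P₂ * (1 + ‖x‖) ^ (-(5 / 2 : ℝ)) * (P₀ * ‖x‖ ^ (-(3 / 4 : ℝ))) :=
          norm_inner_le_of_le (hψ2 x i) (hψ0 x hx) (by positivity)
      _ = P₂ * P₀ * ((1 + ‖x‖) ^ (-(5 / 2 : ℝ)) * ‖x‖ ^ (-(3 / 4 : ℝ))) := by ring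
  have Hψw : ∀ i, Integrable (fun x => (1 + ‖x‖)⁻¹ * |⟪fderiv ℝ ψ x (e i), w x⟫|) volume := by
    intro i
    refine integrable_of_le_one_add_norm_rpow
      (((continuous_const.add continuous_norm).inv₀ fun x => (by positivity : (0:ℝ) < 1 + ‖x‖).ne').mul
        ((hcDψ i).inner hcw).abs).aestronglyMeasurable
      (M := P₁ * A) (r := 23 / 4) (by norm_num) fun x => ?_
    rw [norm_mul, Real.norm_of_nonneg (by positivity), Real.norm_eq_abs, abs_abs, ← Real.norm_eq_abs, hx1]
    calc (1 + ‖x‖) ^ (-(1 : ℝ)) * ‖⟪fderiv ℝ ψ x (e i), w x⟫‖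
        ≤ (1 + ‖x‖) ^ (-(1 : ℝ)) * (P₁ * (1 + ‖x‖) ^ (-(7 / 4 : ℝ)) * (A * (1 + ‖x‖) ^ (-(3 : ℝ)))) :=
          mul_le_mul_of_nonneg_left (norm_inner_le_of_le (hDψi x i) (hwb x) (by positivity))
            (by positivity)
      _ = P₁ * A * ((1 + ‖x‖) ^ (-(1 : ℝ)) * (1 + ‖x‖) ^ (-(7 / 4 : ℝ)) * (1 + ‖x‖) ^ (-(3 : ℝ))) := by
          ring
      _ = P₁ * A * (1 + ‖x‖) ^ (-(23 / 4 : ℝ)) := by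
          rw [one_add_norm_rpow_mul, one_add_norm_rpow_mul]; norm_num
  have Kψw : ∀ i, Integrable (fun x => ⟪fderiv ℝ (fun y => fderiv ℝ ψ y (e i)) x (e i), w x⟫) volume := by
    intro i
    refine integrable_of_le_one_add_norm_rpow ((hcD2ψ i).inner hcw).aestronglyMeasurable
      (M := P₂ * A) (r := 11 / 2) (by norm_num) fun x => ?_
    calc ‖⟪fderiv ℝ (fun y => fderiv ℝ ψ y (e i)) x (e i), w x⟫‖
        ≤ P₂ * (1 + ‖x‖) ^ (-(5 / 2 : ℝ)) * (A * (1 + ‖x‖) ^ (-(3 : ℝ))) :=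
          norm_inner_le_of_le (hψ2 x i) (hwb x) (by positivity)
      _ = P₂ * A * ((1 + ‖x‖) ^ (-(5 / 2 : ℝ)) * (1 + ‖x‖) ^ (-(3 : ℝ))) := by ring
      _ = P₂ * A * (1 + ‖x‖) ^ (-(11 / 2 : ℝ)) := by rw [one_add_norm_rpow_mul]; norm_num
  have Hwψ : ∀ i, Integrable (fun x => (1 + ‖x‖)⁻¹ * |⟪fderiv ℝ w x (e i), ψ x⟫|) volume := by
    intro i
    refine integrable_of_le_one_add_norm_rpow_mul_rpow
      (((continuous_const.add continuous_norm).inv₀ fun x => (by positivity : (0:ℝ) < 1 + ‖x‖).ne').mul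
        ((hcDw i).inner hcψ).abs).aestronglyMeasurable
      (M := A₁ * P₀) (r := 3) (s := 3 / 4) (by norm_num) (by norm_num) (by norm_num) fun x hx => ?_
    rw [norm_mul, Real.norm_of_nonneg (by positivity), Real.norm_eq_abs, abs_abs, ← Real.norm_eq_abs, hx1]
    calc (1 + ‖x‖) ^ (-(1 : ℝ)) * ‖⟪fderiv ℝ w x (e i), ψ x⟫‖
        ≤ (1 + ‖x‖) ^ (-(1 : ℝ)) * (A₁ * (1 + ‖x‖) ^ (-(2 : ℝ)) * (P₀ * ‖x‖ ^ (-(3 / 4 : ℝ)))) :=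
          mul_le_mul_of_nonneg_left (norm_inner_le_of_le (hDwi x i) (hψ0 x hx) (by positivity))
            (by positivity)
      _ = A₁ * P₀ * (((1 + ‖x‖) ^ (-(1 : ℝ)) * (1 + ‖x‖) ^ (-(2 : ℝ))) * ‖x‖ ^ (-(3 / 4 : ℝ))) := by
          ring
      _ = A₁ * P₀ * ((1 + ‖x‖) ^ (-(3 : ℝ)) * ‖x‖ ^ (-(3 / 4 : ℝ))) := by
          rw [one_add_norm_rpow_mul]; norm_num
  have Kwψ : ∀ i, Integrable (fun x => ⟪fderiv ℝ (fun y => fderiv ℝ w y (e i)) x (e i), ψ x⟫) volume := by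
    intro i
    refine integrable_of_le_one_add_norm_rpow_mul_rpow ((hcD2w i).inner hcψ).aestronglyMeasurable
      (M := A₂ * P₀) (r := 3) (s := 3 / 4) (by norm_num) (by norm_num) (by norm_num) fun x hx => ?_
    calc ‖⟪fderiv ℝ (fun y => fderiv ℝ w y (e i)) x (e i), ψ x⟫‖
        ≤ A₂ * (1 + ‖x‖) ^ (-(3 : ℝ)) * (P₀ * ‖x‖ ^ (-(3 / 4 : ℝ))) :=
          norm_inner_le_of_le (hw2 x i) (hψ0 x hx) (by positivity)
      _ = A₂ * P₀ * ((1 + ‖x‖) ^ (-(3 : ℝ)) * ‖x‖ ^ (-(3 / 4 : ℝ))) := by ring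
  have I3' : ∀ i, Integrable (fun x => ⟪fderiv ℝ w x (e i), fderiv ℝ ψ x (e i)⟫) volume := fun i =>
    (I3 i).congr (Eventually.of_forall fun x => real_inner_comm _ _)
  have I2' : ∀ i, Integrable (fun x => ⟪fderiv ℝ ψ x (e i), fderiv ℝ ψ x (e i)⟫) volume := fun i =>
    (I2 i).congr (Eventually.of_forall fun x => (real_inner_self_eq_norm_sq _).symm)
  -- the three Green identities
  have Gψψ := integral_inner_laplacian_add_eq_zero_of_weighted e hψ hψ1' Hψψ I2' Kψψ
  have Gψw := integral_inner_laplacian_add_eq_zero_of_weighted e hψ hw1' Hψw I3 Kψw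
  have Gwψ := integral_inner_laplacian_add_eq_zero_of_weighted e hw hψ1' Hwψ I3' Kwψ
  simp_rw [hΔ] at Gψψ Gψw
  simp_rw [real_inner_self_eq_norm_sq] at Gψψ Gψw
  have hsymm : (∑ i, ∫ x, ⟪fderiv ℝ w x (e i), fderiv ℝ ψ x (e i)⟫) =
      ∑ i, ∫ x, ⟪fderiv ℝ ψ x (e i), fderiv ℝ w x (e i)⟫ :=
    Finset.sum_congr rfl fun i _ => integral_congr_ae (Eventually.of_forall fun x => real_inner_comm _ _)
  rw [hsymm] at Gwψ
  refine ⟨I1, I2, I3, I4, by linarith, by linarith, by linarith⟩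

/-! ## Registered sub-goal (helper stub of `stub_coulombEnergyPackage`) -/

/-- **Registered helper stub `stub_mixedWeightIntegrable`** (crux stmt-NavierStokesRegularity-11717,
line `finite-energy-log-convexity`, helper of S4-E): the mixed reference weight of the Green
identities is integrable on `ℝ³`, as registered. [folklore] -/
theorem stub_mixedWeightIntegrable :
    ∀ (r s : ℝ), 0 ≤ r → s < 3 → 3 < r + s →
      Integrable (fun x : EuclideanSpace ℝ (Fin 3) => (1 + ‖x‖) ^ (-r) * ‖x‖ ^ (-s)) volume :=
  fun _r _s hr hs3 hrs => integrable_one_add_norm_rpow_mul_rpow hr hs3 hrs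

end Summit.NavierStokesRegularity.NavierStokesRegularity.Theorems.RellichScarScarRigidity

end
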